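import Literature.RingTheory.FormalGroups.HochschildFormulaProofs
import Literature.AlgebraicGeometry.Resolution.RegularLocalRingsFlatDescent
import Mathlib.RingTheory.Flat.FaithfullyFlat.Algebra
import Mathlib.LinearAlgebra.Basis.Basic
import Mathlib.LinearAlgebra.FreeModule.Basic
import HarnessLib

/-!
# `WeightedInvariant.DescentPerfectToAll`, line `root-of-a-constant`: the ring of constants of a
# `p`-closed nonsingular derivation of a regular local ring is regular

Route `ResolutionOfSingularities/WeightedInvariant`, crux `DescentPerfectToAll`
(stmt-ResolutionOfSingularities-0549), stub `stub_constantQuotientRegular` of the lead's skeleton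
`work/DescentPerfectToAll.lean` (tool E, the "quotient face" of the one-root-of-a-constant step),
PROVED here (statement verbatim from the ledger registration). It is the REPAIRED form of the
first lemma of the crux-idea card `constant-foliation-descent`
(`Cruxes/DescentPerfectToAll/Disproof.lean` §8, `InvariantsRegularOfPClosedNonsingularDerivation`):
the unrepaired form without `p`-closedness is false
(`…Theorems.DescentPerfectToAll.Negative.not_invariantsRegularOfNonsingularDerivation`, witness
`∂₀ + X₀(X₁∂₁ + X₂∂₂)` on `𝔽_p⟦X₀,X₁,X₂⟧`), and the proof below uses `p`-closedness essentially
(through Hochschild's formula) to make the rescaled derivation nilpotent.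

**Statement.** Let `(R, 𝔪)` be a regular local ring of prime characteristic `p`, `D` a derivation
of `R` which is `p`-closed (`D^p = a·D`) and nonsingular (`D x₀ ∈ Rˣ` for some `x₀`), and
`S = ker D` its ring of constants (with `R` module-finite over `S`). Then `S` is a regular local
ring.

**Proof** (Aramova–Avramov 1986 §1 / Miyanishi–Ito; the argument is the classical "Taylor lemma").
* *Rescale*: `δ := u⁻¹·D`, `u = D x₀`, has the same constants and `δ x₀ = 1`.
* *Nilpotence from `p`-closedness*: by Hochschild's formula
  `(gD)^p = g^p D^p + (gD)^{p-1}(g)·D` (tree: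
  `Literature.RingTheory.FormalGroups.iterate_prime_smul_apply`) and `D^p = a D`, `δ^p = b·D`
  for some `b ∈ R`; evaluating at `x₀`,
  `b u = δ^p x₀ = δ^{p-1}(1) = 0`, so `b = 0` and `δ^p = 0` (`exists_iterate_prime_smul_eq`).
* *Taylor lemma*: for a derivation `δ` with `δ x = 1`, `δ^p = 0` on a ring of characteristic `p`,
  `R` is a free module over `S = ker δ` with basis `1, x, …, x^{p-1}`: spanning by induction on
  the nilpotency index (`δ^{n} r = 0 ⟹ r ∈ Σ_{i<n} S xⁱ`, integrating `δ r` termwise with the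
  units `1/(i+1)`, `i + 1 < p` — `mem_span_of_iterate_eq_zero`), independence by applying `δ` to a
  relation and induction (`eq_zero_of_sum_eq_zero`); whence `Module.Free S R` (`free`).
* *Descent*: a nonzero free module is faithfully flat, so `S` is local, `S → R` is a local
  homomorphism, `S` is Noetherian (ideals of `S` embed into those of `R`; Mathlib
  `Submodule.IsNoetherian.of_isNoetherian_tensorProduct_of_faithfullyFlat`), and regularity
  descends along the flat local map `S → R` (Matsumura 23.7 (i), tree
  `IsRegularLocalRing.of_flat_of_isLocalHom`) (`isRegularLocalRing_of_nilpotent`).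
The hypothesis `Module.Finite S R` of the registered statement is implied by the others and is
not used.

Sources: A. G. Aramova, L. L. Avramov, *Singularities of quotients by vector fields in
characteristic `p`*, Math. Ann. 273 (1986) 629–645, §1; G. Hochschild, Trans. AMS 79 (1955),
Lemma 1; H. Matsumura, *Commutative Ring Theory* (1986), Thm. 23.7 (i) and §25. Mathlib searched
and used: `Derivation` (`leibniz`, `leibniz_pow`, `map_natCast`, `smul_apply`), `Module.Basis.mk`,
`Module.Free.of_basis`, `Fintype.linearIndependent_iff`, `Finset.sum_fin_eq_sum_range`, the
instance `Module.Free → Module.FaithfullyFlat`, `Module.FaithfullyFlat.isLocalRing`,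
`Module.FaithfullyFlat.isLocalHom`, `TensorProduct.AlgebraTensorModule.rid`,
`isNoetherian_of_linearEquiv`; in-tree:
`Literature.RingTheory.FormalGroups.iterate_prime_smul_apply`, `iterate_succ_apply_one`,
`isUnit_natCast_of_not_dvd'` (HochschildFormulaProofs),
`Literature.AlgebraicGeometry.Resolution.IsRegularLocalRing.of_flat_of_isLocalHom`
(RegularLocalRingsFlatDescent). No new definitions.
-/

-- single-problem summit: the doubled namespace component `ResolutionOfSingularities` is forced
set_option linter.dupNamespace false -- mandated namespace of this single-conjunct summit

noncomputable section

open Function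

namespace Summit.ResolutionOfSingularities.ResolutionOfSingularities.Theorems

namespace ConstantQuotientRegular

variable {R : Type*} [CommRing R] (δ : Derivation ℤ R R)

/-! ## Constants of a derivation -/

/-- The inverse of a unit constant of a derivation is a constant: `δ s = 0`, `s t = 1 ⟹ δ t = 0`.
[folklore] -/
theorem apply_eq_zero_of_mul_eq_one {s t : R} (hs : δ s = 0) (hst : s * t = 1) : δ t = 0 := by
  have h := congrArg δ hst
  rw [Derivation.leibniz, Derivation.map_one_eq_zero, hs, smul_zero, add_zero, smul_eq_mul] at h
  calc δ t = s * t * δ t := by rw [hst, one_mul]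
    _ = t * (s * δ t) := by ring
    _ = 0 := by rw [h, mul_zero]

variable (p : ℕ) [Fact p.Prime] [CharP R p]

/-- In characteristic `p`, a natural number `0 < n < p` has an inverse which is a constant of any
derivation. [folklore] -/
theorem exists_natCast_mul_eq_one (S : Subring R) (hS : ∀ y : R, y ∈ S ↔ δ y = 0) {n : ℕ}
    (hn : 0 < n) (hnp : n < p) : ∃ c : S, (n : R) * c = 1 := by
  obtain ⟨w, hw⟩ := Literature.RingTheory.FormalGroups.isUnit_natCast_of_not_dvd' (A := R) p
    (Nat.not_dvd_of_pos_of_lt hn hnp)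
  have hδw : δ (w : R) = 0 := by rw [hw, Derivation.map_natCast]
  refine ⟨⟨(↑w⁻¹ : R), (hS _).2 (apply_eq_zero_of_mul_eq_one δ hδw w.mul_inv)⟩, ?_⟩
  change (n : R) * (↑w⁻¹ : R) = 1
  rw [← hw, Units.mul_inv]

/-- **`p`-closedness survives rescaling** (the consequence of Hochschild's formula
`(gD)^p = g^p D^p + (gD)^{p-1}(g)·D` that is needed): if `D^p = a·D` then `(gD)^p = b·D` for
some `b`. [cite: Hochschild1955, Lemma 1] -/
theorem exists_iterate_prime_smul_eq (D : Derivation ℤ R R) (g a : R)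
    (ha : ∀ y, (⇑D)^[p] y = a * D y) : ∃ b : R, ∀ y, (⇑(g • D))^[p] y = b * D y :=
  ⟨g ^ p * a + (⇑(g • D))^[p - 1] g, fun y => by
    rw [Literature.RingTheory.FormalGroups.iterate_prime_smul_apply p D g y, ha y]; ring⟩

/-! ## The Taylor lemma: `R` is free over the constants of a nilpotent derivation with a slice -/

variable {δ} {x : R} (hx : δ x = 1)
include hx

omit [Fact p.Prime] [CharP R p] in
/-- `δ(x^{i+1}) = (i+1)·xⁱ` when `δ x = 1`. [folklore] -/
theorem apply_pow_succ (i : ℕ) : δ (x ^ (i + 1)) = ((i + 1 : ℕ) : R) * x ^ i := by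
  rw [Derivation.leibniz_pow, hx, Nat.add_sub_cancel, smul_eq_mul, mul_one, nsmul_eq_mul]

variable (S : Subring R) (hS : ∀ y : R, y ∈ S ↔ δ y = 0)
include hS

/-- Termwise integration: every element of `Σ_{i<n} S·xⁱ` (`n < p`) is `δ` of an element of
`Σ_{i<n+1} S·xⁱ`. [folklore] -/
theorem exists_apply_eq_of_mem_span {n : ℕ} (hnp : n < p) {m : R}
    (hm : m ∈ Submodule.span S {y : R | ∃ i < n, y = x ^ i}) :
    ∃ r ∈ Submodule.span S {y : R | ∃ i < n + 1, y = x ^ i}, δ r = m := by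
  induction hm using Submodule.span_induction with
  | mem y hy =>
    obtain ⟨i, hi, rfl⟩ := hy
    obtain ⟨c, hc⟩ := exists_natCast_mul_eq_one δ p S hS (Nat.succ_pos i) (by omega)
    refine ⟨c • x ^ (i + 1), Submodule.smul_mem _ _ (Submodule.subset_span ⟨i + 1, by omega, rfl⟩),
      ?_⟩
    rw [Subring.smul_def, smul_eq_mul, Derivation.leibniz, (hS _).1 c.2, smul_zero, add_zero,
      smul_eq_mul, apply_pow_succ hx, ← mul_assoc, mul_comm (c : R), hc, one_mul]
  | zero => exact ⟨0, Submodule.zero_mem _, map_zero δ⟩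
  | add y z _ _ hy hz =>
    obtain ⟨r, hr, hry⟩ := hy
    obtain ⟨r', hr', hrz⟩ := hz
    exact ⟨r + r', Submodule.add_mem _ hr hr', by rw [map_add, hry, hrz]⟩
  | smul s y _ hy =>
    obtain ⟨r, hr, hry⟩ := hy
    refine ⟨s • r, Submodule.smul_mem _ _ hr, ?_⟩
    rw [Subring.smul_def, smul_eq_mul, Derivation.leibniz, (hS _).1 s.2, smul_zero, add_zero,
      smul_eq_mul, hry, Subring.smul_def, smul_eq_mul]

/-- Spanning half of the Taylor lemma: if `δ^n r = 0` (`n ≤ p`) then `r ∈ Σ_{i<n} S·xⁱ`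
(induction on `n`: integrate `δ r` termwise and correct by a constant). [folklore] -/
theorem mem_span_of_iterate_eq_zero :
    ∀ n ≤ p, ∀ r : R, (⇑δ)^[n] r = 0 → r ∈ Submodule.span S {y : R | ∃ i < n, y = x ^ i} := by
  intro n
  induction n with
  | zero =>
    intro _ r hr
    rw [iterate_zero, id_eq] at hr
    rw [hr]
    exact Submodule.zero_mem _
  | succ n ih =>
    intro hn r hr
    rw [iterate_succ_apply] at hr
    obtain ⟨r', hr', hδ⟩ :=
      exists_apply_eq_of_mem_span p hx S hS (by omega) (ih (by omega) (δ r) hr)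
    have hmem : r - r' ∈ S := by rw [hS, map_sub, hδ, sub_self]
    have h1 : r - r' ∈ Submodule.span S {y : R | ∃ i < n + 1, y = x ^ i} := by
      have : r - r' = (⟨r - r', hmem⟩ : S) • x ^ 0 := by
        rw [Subring.smul_def, smul_eq_mul, pow_zero, mul_one]
      rw [this]
      exact Submodule.smul_mem _ _ (Submodule.subset_span ⟨0, Nat.succ_pos n, rfl⟩)
    have h2 : r = r - r' + r' := by ring
    rw [h2]
    exact Submodule.add_mem _ h1 hr'

/-- Independence half of the Taylor lemma: if `Σ_{i<n} gᵢ xⁱ = 0` (`n ≤ p`) with constant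
coefficients `gᵢ`, then all `gᵢ = 0` (apply `δ` and induct on `n`). [folklore] -/
theorem eq_zero_of_sum_eq_zero : ∀ n ≤ p, ∀ g : ℕ → R, (∀ i < n, δ (g i) = 0) →
    ∑ i ∈ Finset.range n, g i * x ^ i = 0 → ∀ i < n, g i = 0 := by
  intro n
  induction n with
  | zero => intro _ g _ _ i hi; exact absurd hi (Nat.not_lt_zero i)
  | succ n ih =>
    intro hn g hg hsum
    -- apply `δ` to the relation
    have hg' : ∀ i < n, δ (g (i + 1) * ((i + 1 : ℕ) : R)) = 0 := fun i hi => by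
      rw [Derivation.leibniz, Derivation.map_natCast, hg (i + 1) (by omega), smul_zero, smul_zero,
        add_zero]
    have hδsum : ∑ i ∈ Finset.range n, g (i + 1) * ((i + 1 : ℕ) : R) * x ^ i = 0 := by
      have h := congrArg δ hsum
      rw [map_zero, map_sum, Finset.sum_range_succ', pow_zero, mul_one, hg 0 (Nat.succ_pos n),
        add_zero] at h
      rw [← h]
      refine Finset.sum_congr rfl fun i hi => ?_
      have hi' := Finset.mem_range.mp hi
      rw [Derivation.leibniz, hg (i + 1) (by omega), smul_zero, add_zero, smul_eq_mul,
        apply_pow_succ hx]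
      ring
    have htail : ∀ i < n, g (i + 1) = 0 := by
      intro i hi
      have h := ih (by omega) (fun i => g (i + 1) * ((i + 1 : ℕ) : R)) hg' hδsum i hi
      obtain ⟨c, hc⟩ := exists_natCast_mul_eq_one δ p S hS (Nat.succ_pos i) (by omega : i + 1 < p)
      calc g (i + 1) = g (i + 1) * (((i + 1 : ℕ) : R) * c) := by rw [hc, mul_one]
        _ = 0 := by rw [← mul_assoc, h, zero_mul]
    intro i hi
    rcases i with _ | i
    · rw [Finset.sum_range_succ', pow_zero, mul_one, Finset.sum_eq_zero fun i hi => by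
        rw [htail i (Finset.mem_range.mp hi), zero_mul], zero_add] at hsum
      exact hsum
    · exact htail i (by omega)

/-- **Taylor lemma** (freeness): if `δ x = 1` and `δ^p = 0` on a ring of characteristic `p`, then
`R` is a free module over the ring of constants `S = ker δ`, with basis `1, x, …, x^{p-1}`.
[folklore] -/
theorem free (hp : ∀ r : R, (⇑δ)^[p] r = 0) : Module.Free S R := by
  let v : Fin p → R := fun i => x ^ (i : ℕ)
  have hli : LinearIndependent S v := by
    rw [Fintype.linearIndependent_iff]
    intro g hg i
    let G : ℕ → R := fun j => if h : j < p then ((g ⟨j, h⟩ : S) : R) else 0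
    have hG : ∀ (j) (h : j < p), G j = g ⟨j, h⟩ := fun j h => dif_pos h
    have hsum : ∑ j ∈ Finset.range p, G j * x ^ j = 0 := by
      rw [← hg, Finset.sum_fin_eq_sum_range]
      refine Finset.sum_congr rfl fun j hj => ?_
      rw [dif_pos (Finset.mem_range.mp hj), hG j (Finset.mem_range.mp hj), Subring.smul_def,
        smul_eq_mul]
    have hGδ : ∀ j < p, δ (G j) = 0 := fun j hj => by rw [hG j hj]; exact (hS _).1 (g _).2
    have h := eq_zero_of_sum_eq_zero p hx S hS p le_rfl G hGδ hsum i i.isLt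
    rw [hG i i.isLt, Fin.eta] at h
    exact Subtype.ext h
  have hsp : ⊤ ≤ Submodule.span S (Set.range v) := by
    rintro r -
    refine Submodule.span_mono ?_ (mem_span_of_iterate_eq_zero p hx S hS p le_rfl r (hp r))
    rintro _ ⟨i, hi, rfl⟩
    exact ⟨⟨i, hi⟩, rfl⟩
  exact Module.Free.of_basis (Module.Basis.mk hli hsp)

/-- **The ring of constants of a nilpotent derivation with a slice of a regular local ring is
regular**: with `δ x = 1`, `δ^p = 0`, `R` is free of rank `p` over `S` (`free`), hence faithfully
flat; so `S` is local and Noetherian, `S → R` is a flat local homomorphism, and regularity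
descends (Matsumura 23.7 (i)). [cite: Matsumura1987, Thm. 23.7 (i)] -/
theorem isRegularLocalRing_of_nilpotent [IsRegularLocalRing R] (hp : ∀ r : R, (⇑δ)^[p] r = 0) :
    IsRegularLocalRing S := by
  haveI : Module.Free S R := free p hx S hS hp
  haveI : Module.FaithfullyFlat S R := inferInstance
  haveI : IsLocalRing S := Module.FaithfullyFlat.isLocalRing S R
  haveI : IsNoetherianRing S := by
    haveI : IsNoetherian R (TensorProduct S R S) :=
      isNoetherian_of_linearEquiv (TensorProduct.AlgebraTensorModule.rid S R R).symm
    exact Submodule.IsNoetherian.of_isNoetherian_tensorProduct_of_faithfullyFlat ‹_›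
  exact Literature.AlgebraicGeometry.Resolution.IsRegularLocalRing.of_flat_of_isLocalHom S R

end ConstantQuotientRegular

/-- STUB E of the lead's skeleton for crux `DescentPerfectToAll`, line `root-of-a-constant`
(= `Cruxes/DescentPerfectToAll/Disproof.lean` §8, the REPAIRED lemma
`InvariantsRegularOfPClosedNonsingularDerivation`; Aramova–Avramov 1986 §1): the ring of
constants `S` of a `p`-closed (`D^p = a·D`) nonsingular (`D x₀ ∈ Rˣ`) derivation `D` of a regular
local ring `R` of characteristic `p` is a regular local ring. Rescale to `δ = (D x₀)⁻¹ D`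
(`δ x₀ = 1`, same constants); Hochschild's formula and `p`-closedness give `δ^p = b·D` with
`b·D x₀ = δ^{p-1}(1) = 0`, so `δ^p = 0`; conclude by the Taylor lemma and flat descent
(`ConstantQuotientRegular.isRegularLocalRing_of_nilpotent`). [folklore] -/
theorem stub_constantQuotientRegular : ∀ (p : ℕ) [Fact p.Prime] (R : Type) [CommRing R] [IsRegularLocalRing R] [CharP R p] (D : Derivation ℤ R R) (S : Subring R), (∀ x : R, x ∈ S ↔ D x = 0) → Module.Finite S R → (∃ a : R, ∀ x : R, (⇑D)^[p] x = a * D x) → (∃ x : R, IsUnit (D x)) → IsRegularLocalRing S := by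
  intro p hp R _ _ _ D S hS _ ha hx
  obtain ⟨a, ha⟩ := ha
  obtain ⟨x₀, u, hu⟩ := hx
  have hp2 : 2 ≤ p := hp.out.two_le
  -- the rescaled derivation `δ = u⁻¹ D`
  have hδx : ((↑u⁻¹ : R) • D) x₀ = 1 := by
    rw [Derivation.smul_apply, smul_eq_mul, ← hu, Units.inv_mul]
  have hδS : ∀ y : R, y ∈ S ↔ ((↑u⁻¹ : R) • D) y = 0 := fun y => by
    rw [hS, Derivation.smul_apply, smul_eq_mul]
    constructor
    · intro h
      rw [h, mul_zero]
    · intro h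
      calc D y = ↑u * (↑u⁻¹ * D y) := by rw [← mul_assoc, Units.mul_inv, one_mul]
        _ = 0 := by rw [h, mul_zero]
  -- `δ` is nilpotent: Hochschild + `p`-closedness
  obtain ⟨b, hb⟩ := ConstantQuotientRegular.exists_iterate_prime_smul_eq p D (↑u⁻¹ : R) a ha
  have hb0 : b = 0 := by
    have h1 : (⇑((↑u⁻¹ : R) • D))^[p] x₀ = 0 := by
      rw [show p = p - 2 + 1 + 1 by omega, iterate_succ_apply, hδx]
      exact Literature.RingTheory.FormalGroups.iterate_succ_apply_one _ _
    have h2 := hb x₀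
    rw [h1, ← hu] at h2
    calc b = b * ↑u * ↑u⁻¹ := (Units.mul_inv_cancel_right b u).symm
      _ = 0 := by rw [← h2, zero_mul]
  have hδp : ∀ y : R, (⇑((↑u⁻¹ : R) • D))^[p] y = 0 := fun y => by rw [hb y, hb0, zero_mul]
  exact ConstantQuotientRegular.isRegularLocalRing_of_nilpotent p hδx S hδS hδp

end Summit.ResolutionOfSingularities.ResolutionOfSingularities.Theorems

end
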